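import Summits.QuantumFields.YangMills.Theorems.UnitScaleTiltAvgActionDefectLoops
import Literature.MathematicalPhysics.QuantumFieldTheory.Balaban1983to89.TorusLimitAxioms
import HarnessLib

/-!
# S2β · (REG-UP)′ bridge (O2-d) — «THE THIN RECTANGLE»: translating a background by `n` steps in direction `μ` and re-gauging by the STRAIGHT `μ`-transport `g(x) = U₀[x, x+n·e_μ]`
# produces a field `U₀′ := g•τU₀` that is BONDWISE curvature-close to `U₀`: `U₀′(x,ν)·U₀(x,ν)⁻¹ = U₀(∂R_{n×1}(x; μ,ν))` (the holonomy of the thin `n × 1` rectangle), hence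
# `dist1 ≤ n·α` when every plaquette of `U₀` is within `α` of `1`, and `U₀′(x,μ) = U₀(x,μ)` EXACTLY along the translation direction

Cell `ym3-torus` (YM ladder rung R3 = continuum `SU(2)` Yang–Mills on the three-torus at fixed lattice data — a RUNG: NOT d = 4, NOT infinite volume, NOT a mass gap,
NOT Clay).  Width seat «width 12» `ym3-torus-px12` (gen 27); crux `stmt-QuantumFields-20520`, LINE g18-1 S2β, node (REG-UP)′ «the Prop-4 road» (px13 g29), binder `hDcov`:
after (O2-a) ✓`…ChartReadIterTranslate` (translation equivariance of `DΨ_k`) and (O2-c) ✓`…ChartReadIterGaugeCovariance` (gauge covariance of `DΨ_k`), the translated background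
`τU₀` is brought back to `U₀` by the straight transport `g`; THIS FILE is the lattice identity saying the re-gauged translate differs from `U₀` bond by bond by a thin-rectangle holonomy —
the BKG-class input of the background-Lipschitz step (O2-b).  `--kind proof --supports stmt-QuantumFields-20520 --as helper`, count-neutral, DEFINITION-FREE (0 `def`, 0 `instance`,
0 `notation`, 0 `sorry`, default heartbeats).  Generic `P : Params`, level `j`, any `GaugeGroup G`; lit ✓`B10Eq47AxialChi` (`shiftN`, `rowProd`, `rect`, ✓`dist1_rect_le` = non-abelian
Stokes) and ✓`TorusLimitAxioms` (`GaugeField.translate`, `PBond.translate`) VERBATIM; the transport is the term `fun x => rowProd U₀ x μ n` (no new definition).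

WHAT IS PROVED (sorry-free).
* §1 (`rowProd_succ_left` is ✓`AvgActionDefect.rowProd_succ_left`, imported) ★`rect_inv_swap` (`U₀(∂R_{n×1}(x;μ,ν))⁻¹ = U₀(∂R_{1×n}(x;ν,μ))`), ★`dist1_thinRect_le` (`dist1 U₀(∂R_{n×1}) ≤ n·α`
  for EITHER order of `μ ≠ ν`, from ✓`dist1_rect_le`).
* §2 ★★★**`gaugeAct_rowProd_shift_mul_inv_eq_rect`** — with `U₀ᵗ b := U₀ ⟨shiftN b.src μ n, b.dir⟩` (the translate by `n·e_μ`) and `g x := rowProd U₀ x μ n`: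
  **`(g•U₀ᵗ)(x,ν) · U₀(x,ν)⁻¹ = rect U₀ x μ ν n 1`** (pure group algebra on the definitions).
* §3 ★★★**`dist1_gaugeAct_rowProd_shift_mul_inv_le`** — if `dist1 (U₀(∂p)) ≤ α` for every plaquette, then for EVERY bond `b`: **`dist1 ((g•U₀ᵗ) b · (U₀ b)⁻¹) ≤ n·α`**, and the
  companion ★★`gaugeAct_rowProd_shift_eq_self_of_dir` — **`(g•U₀ᵗ)(x,μ) = U₀(x,μ)`** on the bonds of the translation direction (the `(n+1)`-step straight word read two ways);
  ★`dist1_inv_mul_gaugeAct_rowProd_shift_le` — the same bound in the `(U₀ b)⁻¹·U′ b` convention.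
* §4 ★`translate_eq_shiftN` — the dictionary to (O2-a)'s `GaugeField.translate a` whenever `x + a = shiftN x μ n` for all `x` (e.g. `a = Site.scaleTo k e_μ`, `n = L^k`).
USE (hDcov, px13 g29 98552164): `U₀′ := g•τ_aU₀` is the background at which (O2-c) reads `DΨ^{τU₀}`; THIS FILE gives the per-bond closeness `ε₀ = L^l·α₀` (`α₀` = the finest
plaquette class) that (O2-b)'s Lipschitz letter turns into `β`; the same identity one level up (plaquettes of `Ū^jU₀`) gives `ε_j`.

HONEST SCOPE.  Lattice group algebra + the tree's non-abelian Stokes; nothing of Bałaban's renormalisation-group analysis is asserted or proved ([Balaban1985Averaging] (9), (19) pp.19–21 are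
the printed conventions; [Balaban1985RegularSpaces] Lemma 1 p.79 «elementary reasoning»); imports ✓`…UnitScaleTiltAvgActionDefectLoops` for `rowProd_succ_left`; (O2-b), `hDcov`, (REG-UP)′, GAP♯∘ (`stub_uniformFibreGapOrbit`, registry 3732b7df UNTOUCHED, 0∕5), the
five registered stubs, S2β, crux 20520, 19936, 19200, `YM3TorusSU2` — NOT proved; no registered stub is closed; rung R3 — NOT d = 4, NOT infinite volume, NOT a mass gap, NOT Clay; the
Yang–Mills mass gap is NOT proved.
-/

set_option autoImplicit false

namespace Summit.QuantumFields.YangMills.Theorems.FluctuationComparisonRegPrIntLS2BetaThinRectangleTransport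

open Literature.MathematicalPhysics.QuantumFieldTheory.Balaban1983to89
open Literature.MathematicalPhysics.QuantumFieldTheory.Balaban1983to89.B10Eq47AxialChi (shiftN shiftN_zero shiftN_succ rowProd rowProd_zero rowProd_succ rect dist1_rect_le)
open Summit.QuantumFields.YangMills.Theorems.AvgActionDefect (rowProd_succ_left)

variable {P : Params} {j : ℕ} {G : Type*} [GaugeGroup G]

/-! ## §1 Straight words and thin rectangles -/

/-- ★ Reversing a thin rectangle swaps its sides: `U₀(∂R_{n×1}(x;μ,ν))⁻¹ = U₀(∂R_{1×n}(x;ν,μ))`. [cite: Balaban1985Averaging, (9) p.19] -/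
theorem rect_inv_swap (U₀ : GaugeField P j G) (x : Site P j) (μ ν : Fin P.d) (n : ℕ) :
    (rect U₀ x μ ν n 1)⁻¹ = rect U₀ x ν μ 1 n := by
  simp only [rect]
  group

/-- ★ **NON-ABELIAN STOKES FOR A THIN RECTANGLE**, either orientation: if every plaquette is within `α` of `1`, then `dist1 U₀(∂R_{n×1}(x;μ,ν)) ≤ n·α` for `μ ≠ ν`
(✓`dist1_rect_le`; for `ν < μ` through the reversed rectangle). [cite: Balaban1985Averaging, (19) p.21; Balaban1985RegularSpaces, Lemma 1 p.79] -/
theorem dist1_thinRect_le (U₀ : GaugeField P j G) {α : ℝ} (hα : ∀ q : Plaq P j, dist1 (GaugeField.plaqHol U₀ q) ≤ α)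
    (x : Site P j) {μ ν : Fin P.d} (hμν : μ ≠ ν) (n : ℕ) :
    dist1 (rect U₀ x μ ν n 1) ≤ n * α := by
  rcases lt_or_gt_of_ne hμν with h | h
  · refine (dist1_rect_le U₀ x h n 1).trans ?_
    rw [Finset.sum_range_one]
    calc ∑ s ∈ Finset.range n, dist1 (GaugeField.plaqHol U₀ ⟨shiftN (shiftN x ν 0) μ s, μ, ν, h⟩)
        ≤ ∑ s ∈ Finset.range n, α := Finset.sum_le_sum fun s _ => hα _
      _ = n * α := by rw [Finset.sum_const, Finset.card_range, nsmul_eq_mul]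
  · rw [← GaugeGroup.dist1_inv, rect_inv_swap]
    refine (dist1_rect_le U₀ x h 1 n).trans ?_
    calc ∑ t ∈ Finset.range n, ∑ s ∈ Finset.range 1, dist1 (GaugeField.plaqHol U₀ ⟨shiftN (shiftN x μ t) ν s, ν, μ, h⟩)
        ≤ ∑ t ∈ Finset.range n, α := Finset.sum_le_sum fun t _ => by
          rw [Finset.sum_range_one]; exact hα _
      _ = n * α := by rw [Finset.sum_const, Finset.card_range, nsmul_eq_mul]

/-! ## §2 The re-gauged translate against the original: a thin rectangle, bond by bond -/

/-- ★★★ **THE THIN-RECTANGLE IDENTITY**: with the translate `U₀ᵗ b := U₀ ⟨shiftN b.src μ n, b.dir⟩` and the straight transport `g x := rowProd U₀ x μ n`,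
`(g•U₀ᵗ)(x,ν) · U₀(x,ν)⁻¹ = U₀(∂R_{n×1}(x; μ, ν))`. [cite: Balaban1985Averaging, (9), (11) p.19] -/
theorem gaugeAct_rowProd_shift_mul_inv_eq_rect (U₀ : GaugeField P j G) (μ : Fin P.d) (n : ℕ) (b : PBond P j) :
    GaugeField.gaugeAct (fun x : Site P j => rowProd U₀ x μ n) (fun b' : PBond P j => U₀ ⟨shiftN b'.src μ n, b'.dir⟩) b * (U₀ b)⁻¹ =
      rect U₀ b.src μ b.dir n 1 := by
  obtain ⟨x, ν⟩ := b
  show rowProd U₀ x μ n * U₀ ⟨shiftN x μ n, ν⟩ * (rowProd U₀ (x.shift ν) μ n)⁻¹ * (U₀ ⟨x, ν⟩)⁻¹ =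
    rowProd U₀ x μ n * rowProd U₀ (shiftN x μ n) ν 1 * (rowProd U₀ (shiftN x ν 1) μ n)⁻¹ * (rowProd U₀ x ν 1)⁻¹
  simp only [rowProd_succ, rowProd_zero, one_mul, shiftN_succ, shiftN_zero]

/-! ## §3 The bounds -/

/-- ★★★ **BONDWISE CURVATURE-CLOSENESS OF THE RE-GAUGED TRANSLATE**: if `dist1 U₀(∂p) ≤ α` for every plaquette, then for every bond `b`,
`dist1 ((g•U₀ᵗ) b · (U₀ b)⁻¹) ≤ n·α` (`g`, `U₀ᵗ` as in §2). [cite: Balaban1985Averaging, (9), (19) pp.19-21; Balaban1985RegularSpaces, Lemma 1 p.79] -/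
theorem dist1_gaugeAct_rowProd_shift_mul_inv_le (U₀ : GaugeField P j G) {α : ℝ} (hα0 : 0 ≤ α)
    (hα : ∀ q : Plaq P j, dist1 (GaugeField.plaqHol U₀ q) ≤ α) (μ : Fin P.d) (n : ℕ) (b : PBond P j) :
    dist1 (GaugeField.gaugeAct (fun x : Site P j => rowProd U₀ x μ n) (fun b' : PBond P j => U₀ ⟨shiftN b'.src μ n, b'.dir⟩) b * (U₀ b)⁻¹) ≤ n * α := by
  rw [gaugeAct_rowProd_shift_mul_inv_eq_rect]
  by_cases hμν : μ = b.dir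
  · -- along the translation direction the rectangle degenerates: `R_{n×1}(x; μ, μ) = 1`
    subst hμν
    have h1 : rect U₀ b.src b.dir b.dir n 1 = 1 := by
      simp only [rect, rowProd_succ, rowProd_zero, one_mul, shiftN_succ, shiftN_zero]
      rw [← rowProd_succ, rowProd_succ_left]
      group
    rw [h1, GaugeGroup.dist1_one]
    exact mul_nonneg (Nat.cast_nonneg _) hα0
  · exact dist1_thinRect_le U₀ hα b.src hμν n

/-- ★★ **EXACT ALONG THE TRANSLATION DIRECTION**: `(g•U₀ᵗ)(x,μ) = U₀(x,μ)` (the straight word of length `n+1` from `x`, read as `U₀(x,μ)·U₀[x+e_μ,…]` and as `U₀[x,…]·U₀(x+n e_μ, μ)`).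
[cite: Balaban1985Averaging, (9) p.19] -/
theorem gaugeAct_rowProd_shift_eq_self_of_dir (U₀ : GaugeField P j G) (μ : Fin P.d) (n : ℕ) (x : Site P j) :
    GaugeField.gaugeAct (fun x : Site P j => rowProd U₀ x μ n) (fun b' : PBond P j => U₀ ⟨shiftN b'.src μ n, b'.dir⟩) ⟨x, μ⟩ = U₀ ⟨x, μ⟩ := by
  have h := gaugeAct_rowProd_shift_mul_inv_eq_rect U₀ μ n ⟨x, μ⟩
  have h1 : rect U₀ x μ μ n 1 = 1 := by
    simp only [rect, rowProd_succ, rowProd_zero, one_mul, shiftN_succ, shiftN_zero]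
    rw [← rowProd_succ, rowProd_succ_left]
    group
  rw [h1] at h
  exact mul_inv_eq_one.1 h

/-- ★ The same bound in the `(U₀ b)⁻¹·U′ b` convention (`dist1` is conjugation invariant). [cite: Balaban1985Averaging, (19) p.21] -/
theorem dist1_inv_mul_gaugeAct_rowProd_shift_le (U₀ : GaugeField P j G) {α : ℝ} (hα0 : 0 ≤ α)
    (hα : ∀ q : Plaq P j, dist1 (GaugeField.plaqHol U₀ q) ≤ α) (μ : Fin P.d) (n : ℕ) (b : PBond P j) :
    dist1 ((U₀ b)⁻¹ * GaugeField.gaugeAct (fun x : Site P j => rowProd U₀ x μ n) (fun b' : PBond P j => U₀ ⟨shiftN b'.src μ n, b'.dir⟩) b) ≤ n * α := by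
  have h := dist1_gaugeAct_rowProd_shift_mul_inv_le U₀ hα0 hα μ n b
  have e : (U₀ b)⁻¹ * GaugeField.gaugeAct (fun x : Site P j => rowProd U₀ x μ n) (fun b' : PBond P j => U₀ ⟨shiftN b'.src μ n, b'.dir⟩) b =
      (U₀ b)⁻¹ * (GaugeField.gaugeAct (fun x : Site P j => rowProd U₀ x μ n) (fun b' : PBond P j => U₀ ⟨shiftN b'.src μ n, b'.dir⟩) b * (U₀ b)⁻¹) * ((U₀ b)⁻¹)⁻¹ := by
    group
  rw [e, GaugeGroup.dist1_conj]
  exact h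

/-! ## §4 Dictionary to `GaugeField.translate` -/

omit [GaugeGroup G] in
/-- ★ If `x + a = x + n·e_μ` for all sites, the translate `τ_a U₀` of lit ✓`TorusLimitAxioms` is the field `b ↦ U₀ ⟨shiftN b.src μ n, b.dir⟩` of this file. [folklore] -/
theorem translate_eq_shiftN (U₀ : GaugeField P j G) (a : Site P j) (μ : Fin P.d) (n : ℕ) (ha : ∀ x : Site P j, x + a = shiftN x μ n) :
    U₀.translate a = fun b' : PBond P j => U₀ ⟨shiftN b'.src μ n, b'.dir⟩ := by
  funext b
  rw [GaugeField.translate_apply]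
  obtain ⟨x, ν⟩ := b
  show U₀ ⟨x + a, ν⟩ = U₀ ⟨shiftN x μ n, ν⟩
  rw [ha]

end Summit.QuantumFields.YangMills.Theorems.FluctuationComparisonRegPrIntLS2BetaThinRectangleTransport
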